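import Literature.NumberTheory.Weil1965.SiegelWeilNarrowRayBound
import Literature.NumberTheory.Weil1965.SiegelWeilBorelBoundReduction
import HarnessLib

/-!
# The Borel bound (**)′ of the rank-one Siegel–Weil formula: narrow ray + reduction, assembled

[Weil1965] n° 47–50 (Lemmes 20–23, Thm. 4), sheet `SW2c-BOUND-ASSEMBLY.v0` §1/§3 of the Hodge-CM cell:
the NORMALISED Borel bound
  (**)′  `‖E(ω(p)Φ)‖ ≤ M · L(p)^{1/2}`  for every `p` in the Borel image `P ⊆ Mp`,
for a functional `E` on `𝒮(𝔸_F^m)` (the difference `I□ − κ·eis` of the doubled theta integral and the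
Siegel–Eisenstein functional), assembled from
* ★ `SiegelWeilNarrowRayBound.exists_narrowRay_bound` — the narrow-ray bound on the GOOD set `G`, uniformly
  over the dominated family `{ω(q_k)Φ : q_k ∈ Q}`, and
* ★ `SiegelWeilBorelBoundReduction.norm_apply_omega_le_of_forall_reduction` — the wide-ray reduction
  (`E` invariant under the rational isometric elements `R`, reduction `π(q⁻¹ r p) = π(q_k)`).
The only new input is the COORDINATE hypothesis on the good set (the frame letters (L-N), (L-D) of the sheet):
every `q ∈ G` ACTS as a Borel translate `chirp(β • S) ∘ twist(a · z(ρ)⁻¹)` with `β ∈ K_β`, `a ∈ A`,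
`0 < ρ ≤ 1`; its modulus `L(q) = |det(a z(ρ)⁻¹)|⁻¹ = ρ^{m[F:ℚ]}|det a|⁻¹` is then COMPUTED
(`l2Scaling_of_omega_eq_chirpLM_twistLM`), so that the narrow-ray bound `MB · ρ^{m[F:ℚ]/2}` is
`≤ MB √D₁ · L(q)^{1/2}` (`|det a| ≤ D₁` on `A`), which is the `hB`-shape of the reduction step.
All analytic and group-theoretic inputs remain hypotheses in the sheet's shapes ((INV), (RED), (DOM), (Î),
(E_X), (E1), (E3′)); the cell's `Theorems/H413E2SWBorelBound.lean` instantiates them by name.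
HC_CM is proved only modulo the printed citations until rung 0 closes.

References: A. Weil, *Sur la formule de Siegel dans la théorie des groupes classiques*, Acta Math. 113
(1965), n° 47–50 [Weil1965]; A. Weil, *Sur certains groupes d'opérateurs unitaires*, Acta Math. 111
(1964), Chap. I n° 13 [Weil1964].
-/

set_option autoImplicit false

noncomputable section

open scoped NNReal ENNReal Matrix Classical
open NumberField IsDedekindDomain MeasureTheory Matrix

namespace Literature.NumberTheory.Weil1964

open Literature.NumberTheory.Automorphic Literature.RepresentationTheory.HeisenbergGroup

variable (F : Type) [Field F] [NumberField F] {m : ℕ}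
variable (T : Matrix (Fin m) (Fin m) (AdeleRing (𝓞 F) F)) (hT : IsUnit T.det)
variable [MeasurableSpace (AdeleRing (𝓞 F) F)] [BorelSpace (AdeleRing (𝓞 F) F)]
variable (ν : Measure (Fin m → AdeleRing (𝓞 F) F)) [ν.IsAddHaarMeasure]

/-! ## §1 The modulus of a Borel translate -/

/-- **If `ω(q)` acts as `chirp(S′) ∘ twist(g)` then `L(q) = |det g⁻¹|_𝔸`** (chirps are unimodular, the module of
`x ↦ x g` is `|det g|_𝔸`). [cite: Weil1964, Chap. I n° 13 p. 160] -/
theorem adelicMpCont.l2Scaling_of_omega_eq_chirpLM_twistLM (q : adelicMpCont F (Fin m) T)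
    (S' : Matrix (Fin m) (Fin m) (AdeleRing (𝓞 F) F)) (g : GL (Fin m) (AdeleRing (𝓞 F) F))
    (hq : ∀ Φ : piSchwartzBruhat F (Fin m), adelicMpCont.omega F (Fin m) T q Φ = chirpLM F S' (twistLM F g Φ)) :
    adelicMpCont.l2Scaling F T hT ν q = ((adelicAbsDet m F g⁻¹ : ℝ≥0) : ℝ≥0∞) := by
  refine adelicMpCont.l2Scaling_eq_of_forall F T hT ν q fun Φ => ?_
  have hcoe : ((adelicMpCont.omega F (Fin m) T q Φ : piSchwartzBruhat F (Fin m)) : (Fin m → AdeleRing (𝓞 F) F) → ℂ) =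
      chirp F S' (Literature.NumberTheory.Weil1964.twist F g ((Φ : piSchwartzBruhat F (Fin m)) : (Fin m → AdeleRing (𝓞 F) F) → ℂ)) := by
    rw [hq Φ, coe_chirpLM, coe_twistLM]
  rw [hcoe, lintegral_enorm_sq_chirp, lintegral_enorm_sq_twist]

/-- `L(q) = ρ^{m[F:ℚ]} |det a|⁻¹` for a Borel translate `chirp(S′) ∘ twist(a z(ρ)⁻¹)`. [cite: Weil1964, Chap. I n° 13 p. 160] -/
theorem adelicMpCont.l2Scaling_of_omega_eq_borelTranslate (q : adelicMpCont F (Fin m) T)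
    (S' : Matrix (Fin m) (Fin m) (AdeleRing (𝓞 F) F)) (a : GL (Fin m) (AdeleRing (𝓞 F) F)) (ρ : ℝ≥0ˣ)
    (hq : ∀ Φ : piSchwartzBruhat F (Fin m),
      adelicMpCont.omega F (Fin m) T q Φ = chirpLM F S' (twistLM F (a * (posRealScalar m F ρ)⁻¹) Φ)) :
    adelicMpCont.l2Scaling F T hT ν q =
      ((((ρ : ℝ≥0) ^ Module.finrank ℚ F) ^ m * (adelicAbsDet m F a)⁻¹ : ℝ≥0) : ℝ≥0∞) :=
  (adelicMpCont.l2Scaling_of_omega_eq_chirpLM_twistLM F T hT ν q S' (a * (posRealScalar m F ρ)⁻¹) hq).trans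
    (congrArg (fun z : ℝ≥0 => (z : ℝ≥0∞)) (adelicAbsDet_inv_ray F a ρ))

/-! ## §2 The assembled Borel bound -/

/-- **THE NORMALISED BOREL BOUND (**)′, assembled.** Hypotheses, in the shapes of the sheet
`SW2c-BOUND-ASSEMBLY.v0`: the rational isometric invariance `hE`/`hR` (INV); the reduction `hred` (RED) through
the good set `G` and the implementers `Q` of the compact part with moduli `≥ c₁` (DOM: `hQ`); the COORDINATES of
the good set, skolemised as `βc, ac, ρc` with `hGβ hGa hGρ hGω` ((L-N)+(L-D)+RED's parametrisation: `q ∈ G` acts as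
`chirp(βc q • S) ∘ twist(ac q · z(ρc q)⁻¹)`, `βc q ∈ K_β`, `ac q ∈ A`, `ρc q ≤ 1`) with `|det a| ≤ D₁` on `A`; and the NARROW-RAY BOUND `hNarrow` in the shape delivered by
★ `SiegelWeilNarrowRayBound.exists_narrowRay_bound` for the family `{ω(q_k)Φ : q_k ∈ Q}`.
Conclusion: `∃ M, ∀ p ∈ P, ‖E(ω p Φ)‖ ≤ M · √L(p)` — the modulus of the good point being COMPUTED from its
coordinates (`l2Scaling_of_omega_eq_borelTranslate`). [cite: Weil1965, n° 47–50 (Lemmes 20–23, Thm. 4)] -/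
theorem exists_borelBound (S : Matrix (Fin m) (Fin m) (AdeleRing (𝓞 F) F))
    (E : piSchwartzBruhat F (Fin m) →ₗ[ℂ] ℂ) (Φ : piSchwartzBruhat F (Fin m))
    -- (INV), (RED), (DOM)
    (P G R Q : Set (adelicMpCont F (Fin m) T))
    (hE : ∀ r ∈ R, E ∘ₗ adelicMpCont.omega F (Fin m) T r⁻¹ = E)
    (hR : ∀ r ∈ R, adelicMpCont.l2Scaling F T hT ν r = 1)
    {c₁ : ℝ} (hc₁ : 0 < c₁) (hQ : ∀ qk ∈ Q, c₁ ≤ (adelicMpCont.l2Scaling F T hT ν qk).toReal)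
    (hred : ∀ p ∈ P, ∃ r ∈ R, ∃ q ∈ G, ∃ qk ∈ Q,
      adelicMpCont.proj F (Fin m) T (q⁻¹ * r * p) = adelicMpCont.proj F (Fin m) T qk)
    -- coordinates of the good set ((L-N), (L-D), RED's parametrisation) and the base twists
    (A : Set (GL (Fin m) (AdeleRing (𝓞 F) F))) (Kβ : Set (AdeleRing (𝓞 F) F))
    (βc : adelicMpCont F (Fin m) T → AdeleRing (𝓞 F) F) (ac : adelicMpCont F (Fin m) T → GL (Fin m) (AdeleRing (𝓞 F) F))
    (ρc : adelicMpCont F (Fin m) T → ℝ≥0ˣ)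
    (hGβ : ∀ q ∈ G, βc q ∈ Kβ) (hGa : ∀ q ∈ G, ac q ∈ A) (hGρ : ∀ q ∈ G, (ρc q : ℝ≥0) ≤ 1)
    (hGω : ∀ q ∈ G, ∀ Ψ : piSchwartzBruhat F (Fin m),
      adelicMpCont.omega F (Fin m) T q Ψ = chirpLM F (βc q • S) (twistLM F (ac q * (posRealScalar m F (ρc q))⁻¹) Ψ))
    {D₁ : ℝ≥0} (hdet' : ∀ a ∈ A, adelicAbsDet m F a ≤ D₁)
    -- the narrow-ray bound on the translated family (★ `exists_narrowRay_bound`)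
    {MB : ℝ≥0∞} (hMB : MB ≠ ⊤)
    (hNarrow : ∀ β ∈ Kβ, ∀ a ∈ A, ∀ ρ : ℝ≥0ˣ, (ρ : ℝ≥0) ≤ 1 → ∀ qk ∈ Q,
      (‖E (chirpLM F (β • S) (twistLM F (a * (posRealScalar m F ρ)⁻¹) (adelicMpCont.omega F (Fin m) T qk Φ)))‖ₑ :
        ℝ≥0∞) ≤ MB * ENNReal.ofReal (((ρ : ℝ≥0) : ℝ) ^ ((m : ℝ) * Module.finrank ℚ F / 2))) :
    ∃ Mbound : ℝ, ∀ p ∈ P, ‖E (adelicMpCont.omega F (Fin m) T p Φ)‖ ≤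
      Mbound * Real.sqrt (adelicMpCont.l2Scaling F T hT ν p).toReal := by
  -- convert it to the `hB`-shape of the reduction step: `‖E(ω q (ω qk Φ))‖ ≤ MB √D₁ · √L(q)`
  have hB' : ∀ q ∈ G, ∀ qk ∈ Q,
      ‖E (adelicMpCont.omega F (Fin m) T q (adelicMpCont.omega F (Fin m) T qk Φ))‖ ≤
        MB.toReal * Real.sqrt (D₁ : ℝ) * Real.sqrt (adelicMpCont.l2Scaling F T hT ν q).toReal := by
    intro q hq qk hqk
    have hβ := hGβ q hq
    have ha := hGa q hq
    have hρ := hGρ q hq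
    have hqω := hGω q hq
    have hρ0 : (0 : ℝ) < ((ρc q : ℝ≥0) : ℝ) := NNReal.coe_pos.2 (Units.ne_zero (ρc q) |>.bot_lt)
    -- the narrow-ray bound at this point
    have h1 := hNarrow (βc q) hβ (ac q) ha (ρc q) hρ qk hqk
    -- `‖·‖ ≤ (MB · ofReal(ρ^{md/2})).toReal = MB.toReal · ρ^{md/2}`, transported along `hqω` WITHOUT rewriting
    have e : ‖E (adelicMpCont.omega F (Fin m) T q (adelicMpCont.omega F (Fin m) T qk Φ))‖ =
        ‖E (chirpLM F (βc q • S) (twistLM F (ac q * (posRealScalar m F (ρc q))⁻¹)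
          (adelicMpCont.omega F (Fin m) T qk Φ)))‖ :=
      congrArg (fun Ψ : piSchwartzBruhat F (Fin m) => ‖E Ψ‖) (hqω (adelicMpCont.omega F (Fin m) T qk Φ))
    have h1' := (ENNReal.ofReal_le_iff_le_toReal (ENNReal.mul_ne_top hMB ENNReal.ofReal_ne_top)).1
      ((ofReal_norm _).trans_le h1)
    have htoReal : (MB * ENNReal.ofReal (((ρc q : ℝ≥0) : ℝ) ^ ((m : ℝ) * Module.finrank ℚ F / 2))).toReal =
        MB.toReal * ((ρc q : ℝ≥0) : ℝ) ^ ((m : ℝ) * Module.finrank ℚ F / 2) := by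
      rw [ENNReal.toReal_mul, ENNReal.toReal_ofReal (Real.rpow_nonneg hρ0.le _)]
    have h2 : ‖E (adelicMpCont.omega F (Fin m) T q (adelicMpCont.omega F (Fin m) T qk Φ))‖ ≤
        MB.toReal * ((ρc q : ℝ≥0) : ℝ) ^ ((m : ℝ) * Module.finrank ℚ F / 2) :=
      e.trans_le (h1'.trans_eq htoReal)
    -- `ρ^{md/2} ≤ √D₁ · √L(q)` since `L(q) = ρ^{md} |det a|⁻¹` and `|det a| ≤ D₁`
    have hL := adelicMpCont.l2Scaling_of_omega_eq_borelTranslate F T hT ν q (βc q • S) (ac q) (ρc q) hqω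
    have hdeta0 : (0 : ℝ) < ((adelicAbsDet m F (ac q) : ℝ≥0) : ℝ) := adelicAbsDet_pos (ac q)
    have h3 : ((ρc q : ℝ≥0) : ℝ) ^ ((m : ℝ) * Module.finrank ℚ F / 2) ≤
        Real.sqrt (D₁ : ℝ) * Real.sqrt (adelicMpCont.l2Scaling F T hT ν q).toReal := by
      rw [hL, ENNReal.coe_toReal, NNReal.coe_mul, NNReal.coe_pow, NNReal.coe_pow, NNReal.coe_inv, ← Real.sqrt_mul (NNReal.coe_nonneg _)]
      have hρpow : ((ρc q : ℝ≥0) : ℝ) ^ ((m : ℝ) * Module.finrank ℚ F / 2) =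
          Real.sqrt ((((ρc q : ℝ≥0) : ℝ) ^ Module.finrank ℚ F) ^ m) := by
        rw [← pow_mul, ← Real.rpow_natCast, Real.sqrt_eq_rpow, ← Real.rpow_mul hρ0.le]
        congr 1
        push_cast
        ring
      rw [hρpow]
      refine Real.sqrt_le_sqrt ?_
      -- `(ρ^d)^m ≤ D₁ · ((ρ^d)^m · |det a|⁻¹)`
      have hD : (1 : ℝ) ≤ (D₁ : ℝ) * ((adelicAbsDet m F (ac q) : ℝ≥0) : ℝ)⁻¹ := by
        rw [← div_eq_mul_inv, one_le_div hdeta0]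
        exact NNReal.coe_le_coe.2 (hdet' (ac q) ha)
      calc (((ρc q : ℝ≥0) : ℝ) ^ Module.finrank ℚ F) ^ m = (((ρc q : ℝ≥0) : ℝ) ^ Module.finrank ℚ F) ^ m * 1 := (mul_one _).symm
        _ ≤ (((ρc q : ℝ≥0) : ℝ) ^ Module.finrank ℚ F) ^ m * ((D₁ : ℝ) * ((adelicAbsDet m F (ac q) : ℝ≥0) : ℝ)⁻¹) :=
            mul_le_mul_of_nonneg_left hD (by positivity)
        _ = (D₁ : ℝ) * ((((ρc q : ℝ≥0) : ℝ) ^ Module.finrank ℚ F) ^ m * ((adelicAbsDet m F (ac q) : ℝ≥0) : ℝ)⁻¹) := by ring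
    calc ‖E (adelicMpCont.omega F (Fin m) T q (adelicMpCont.omega F (Fin m) T qk Φ))‖
        ≤ MB.toReal * ((ρc q : ℝ≥0) : ℝ) ^ ((m : ℝ) * Module.finrank ℚ F / 2) := h2
      _ ≤ MB.toReal * (Real.sqrt (D₁ : ℝ) * Real.sqrt (adelicMpCont.l2Scaling F T hT ν q).toReal) :=
          mul_le_mul_of_nonneg_left h3 ENNReal.toReal_nonneg
      _ = _ := by ring
  -- the reduction step
  exact ⟨MB.toReal * Real.sqrt (D₁ : ℝ) / Real.sqrt c₁,
    norm_apply_omega_le_of_forall_reduction F T hT ν E Φ P G R Q hE hR hc₁ hQ hred hB'⟩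

end Literature.NumberTheory.Weil1964

end
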